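import Mathlib
import HarnessLib
import Summits.ValiantsHypothesis.ValiantsHypothesis.Theorems.MonotoneRestorationOrbitRestorationQPStableForms
import Summits.ValiantsHypothesis.ValiantsHypothesis.Theorems.MonotoneRestorationOrbitRestorationQPInjectivePlacementProducts

/-!
# Untwisted `ΠΣ` in SPAN currency, end to end: a G-STABLE family of placed local affine forms has a narrow product

Route MonotoneRestoration, crux `OrbitRestorationQP` (stmt-ValiantsHypothesis-18293), SPAN-currency lane of the open
sub-rung A_∞ (`stub_sigmaPiSigmaValue`); evidence note `SPAN-CURRENCY-A1-g7g4.md` §7 step (S2).  Helper (`--supports`),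
def-free.

THE THEOREM (`prod_mem_narrowSpan_of_stable_localFactors`).  Let `(L_i)_{i ∈ ι}` be a finite family of polynomials on the
`n × n` matrix such that
 (stable) for all row/column permutations `(σ, τ)` there is a permutation `κ` of `ι` with `(σ,τ)·L_i = L_{κ i}` — the factor
   family is EXACTLY permuted (this is "untwisted"; by unique factorisation it holds for the factors of a matrix-symmetric affine
   product up to units, `LocalFactors.exists_assoc_mem_of_vact`, and exactly when no line-stabiliser character intervenes);
 (local)  every `L_i` is a local affine form `β₀ + δU + Σ α x_{e_R a, e_C b} + Σ β R_{e_R a} + Σ γ C_{e_C b}` placed at injective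
   `e_R : Fin r ↪ [n]`, `e_C : Fin c ↪ [n]` with `r + c + 1 ≤ w` (`LocalFactors.exists_rowColSupports_of_matrixSymmetric` +
   `LocalFormShape.eq_localForm_of_rowCol_invariant`).
Then `Π_i L_i ∈ span_ℂ {hom_{F,n} : tw F ≤ w}` — constant treewidth, hence POLYNOMIAL orbits for the whole untwisted `ΠΣ` class.

Proof (kernel): Newton in span currency on the whole family (`NarrowSpanNewton`); the power sums `P_m = Σ_i L_i^m` satisfy
`|G| · P_m = Σ_{g ∈ G} Σ_i (g·L_i)^m` by (stable); `(σ,τ)·ℓ^{e_R,e_C} = ℓ^{σ∘e_R, τ∘e_C}` (`rename_localForm`); and averaging a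
function of `σ ∘ e` over all permutations `σ` is a positive multiple of its sum over injective placements
(`exists_sum_perm_comp_eq`, constant fibres by translation, `StableForms.exists_perm_extend`) — so `|G| · P_m` is a
combination of the injective-placement power sums of INJ (`sum_injective_injective_pow_affineLocalForm_mem_narrowSpan`).

Honest label: the untwisted `ΠΣ` sub-class of A₁ in span currency with constant treewidth; the remaining glue to
`IsMatrixSymmetric` families is choosing untwisted representatives (when they exist); twisted orbits need the pairing of
`…ColumnVandermondesNarrow.lean`.  No stub closed; VP ≠ VNP untouched.
-/

noncomputable section

-- `Summit.ValiantsHypothesis.ValiantsHypothesis.…` is the tree's single-conjunct layout (Sub = Summit).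
set_option linter.dupNamespace false

namespace Summit.ValiantsHypothesis.ValiantsHypothesis.Theorems

namespace CorePatterns

open MvPolynomial Finset Equiv
open Literature.Computability.AlgebraicComplexity (homPoly)
open Literature.Combinatorics.SimpleGraph (treewidth)

/-! ### Averaging over permutations vs. summing over injective placements -/

/-- Extending an injective placement: some permutation `π` has `π ∘ e = φ`. [folklore] -/
theorem exists_perm_comp_eq {n r : ℕ} (e φ : Fin r → Fin n) (he : Function.Injective e) (hφ : Function.Injective φ) :
    ∃ π : Perm (Fin n), π ∘ e = φ := by
  classical
  set f : Fin n → Fin n := fun x => if h : ∃ i, e i = x then φ h.choose else x with hf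
  have hfe : ∀ i, f (e i) = φ i := by
    intro i
    have hex : ∃ j, e j = e i := ⟨i, rfl⟩
    simp only [hf, dif_pos hex]
    congr 1
    exact he hex.choose_spec
  have hinj : Set.InjOn f ↑((univ : Finset (Fin r)).image e) := by
    intro x hx y hy hxy
    simp only [coe_image, coe_univ, Set.image_univ, Set.mem_range] at hx hy
    obtain ⟨i, rfl⟩ := hx
    obtain ⟨j, rfl⟩ := hy
    rw [hfe, hfe] at hxy
    rw [hφ hxy]
  obtain ⟨π, hπ⟩ := StableForms.exists_perm_extend hinj
  refine ⟨π, funext fun i => ?_⟩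
  rw [Function.comp_apply, hπ (e i) (mem_image_of_mem _ (mem_univ _)), hfe]

/-- **The number of permutations extending an injective placement does not depend on the placement.** [folklore] -/
theorem card_filter_comp_eq_const {n r : ℕ} (e φ : Fin r → Fin n) (he : Function.Injective e) (hφ : Function.Injective φ) :
    ((univ : Finset (Perm (Fin n))).filter (fun σ : Perm (Fin n) => ⇑σ ∘ e = φ)).card =
      ((univ : Finset (Perm (Fin n))).filter (fun σ : Perm (Fin n) => ⇑σ ∘ e = e)).card := by
  classical
  obtain ⟨π, hπ⟩ := exists_perm_comp_eq e φ he hφ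
  symm
  refine Finset.card_bij (fun σ _ => π * σ) ?_ ?_ ?_
  · intro σ hσ
    simp only [mem_filter, mem_univ, true_and] at hσ ⊢
    rw [Perm.coe_mul, Function.comp_assoc, hσ, hπ]
  · intro σ₁ _ σ₂ _ h
    exact mul_left_cancel h
  · intro σ' hσ'
    simp only [mem_filter, mem_univ, true_and] at hσ'
    refine ⟨π⁻¹ * σ', ?_, by group⟩
    simp only [mem_filter, mem_univ, true_and]
    rw [Perm.coe_mul, Function.comp_assoc, hσ', ← hπ, ← Function.comp_assoc, ← Perm.coe_mul, inv_mul_cancel,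
      Perm.coe_one, Function.id_comp]

/-- **Averaging over permutations = a positive multiple of summing over injective placements.** [folklore] -/
theorem exists_sum_perm_comp_eq {n r : ℕ} (e : Fin r → Fin n) (he : Function.Injective e) :
    ∃ N : ℕ, N ≠ 0 ∧ ∀ F : (Fin r → Fin n) → MvPolynomial (Fin n × Fin n) ℂ,
      (∑ σ : Perm (Fin n), F (⇑σ ∘ e)) =
        N • ∑ φ ∈ (univ : Finset (Fin r → Fin n)).filter (fun φ => Function.Injective φ), F φ := by
  classical
  refine ⟨((univ : Finset (Perm (Fin n))).filter (fun σ : Perm (Fin n) => ⇑σ ∘ e = e)).card, ?_, fun F => ?_⟩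
  · exact Finset.card_ne_zero.2 ⟨1, by simp⟩
  · rw [← Finset.sum_fiberwise' (univ : Finset (Perm (Fin n))) (fun σ => ⇑σ ∘ e) F]
    rw [Finset.smul_sum, ← Finset.sum_filter_add_sum_filter_not (univ : Finset (Fin r → Fin n))
      (fun φ => Function.Injective φ)]
    have hzero : (∑ φ ∈ (univ : Finset (Fin r → Fin n)).filter (fun φ => ¬ Function.Injective φ),
        ∑ σ ∈ (univ : Finset (Perm (Fin n))).filter (fun σ : Perm (Fin n) => ⇑σ ∘ e = φ), F φ) = 0 := by
      refine Finset.sum_eq_zero fun φ hφ => Finset.sum_eq_zero fun σ hσ => ?_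
      exact absurd ((mem_filter.1 hσ).2 ▸ σ.injective.comp he) (mem_filter.1 hφ).2
    rw [hzero, add_zero]
    refine Finset.sum_congr rfl fun φ hφ => ?_
    rw [Finset.sum_const, card_filter_comp_eq_const e φ he (mem_filter.1 hφ).2]

/-! ### Renaming a placed local form -/

/-- **`(σ,τ)` acts on a placed local affine form by moving the placement.** [folklore] -/
theorem rename_localForm (n r c : ℕ) (β₀ δ : ℂ) (α : Fin r × Fin c → ℂ) (β : Fin r → ℂ) (γ : Fin c → ℂ)
    (φ : Fin r → Fin n) (ψ : Fin c → Fin n) (σ τ : Perm (Fin n)) :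
    rename (fun P : Fin n × Fin n => (σ P.1, τ P.2))
      ((C β₀ + C δ * ∑ i : Fin n, ∑ j : Fin n, (X (i, j) : MvPolynomial (Fin n × Fin n) ℂ)) +
        ((∑ ab : Fin r × Fin c, C (α ab) * (X (φ ab.1, ψ ab.2) : MvPolynomial (Fin n × Fin n) ℂ)) +
          (∑ a : Fin r, C (β a) * ∑ j : Fin n, (X (φ a, j) : MvPolynomial (Fin n × Fin n) ℂ)) +
          (∑ b : Fin c, C (γ b) * ∑ j : Fin n, (X (j, ψ b) : MvPolynomial (Fin n × Fin n) ℂ)))) =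
    (C β₀ + C δ * ∑ i : Fin n, ∑ j : Fin n, (X (i, j) : MvPolynomial (Fin n × Fin n) ℂ)) +
        ((∑ ab : Fin r × Fin c, C (α ab) * (X ((⇑σ ∘ φ) ab.1, (⇑τ ∘ ψ) ab.2) : MvPolynomial (Fin n × Fin n) ℂ)) +
          (∑ a : Fin r, C (β a) * ∑ j : Fin n, (X ((⇑σ ∘ φ) a, j) : MvPolynomial (Fin n × Fin n) ℂ)) +
          (∑ b : Fin c, C (γ b) * ∑ j : Fin n, (X (j, (⇑τ ∘ ψ) b) : MvPolynomial (Fin n × Fin n) ℂ))) := by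
  simp only [map_add, map_mul, rename_C, map_sum, rename_X, Function.comp_apply]
  have hU : (∑ i : Fin n, ∑ j : Fin n, (X (σ i, τ j) : MvPolynomial (Fin n × Fin n) ℂ)) =
      ∑ i : Fin n, ∑ j : Fin n, (X (i, j) : MvPolynomial (Fin n × Fin n) ℂ) := by
    rw [Equiv.sum_comp σ (fun i => ∑ j : Fin n, (X (i, τ j) : MvPolynomial (Fin n × Fin n) ℂ))]
    exact Finset.sum_congr rfl fun i _ =>
      Equiv.sum_comp τ (fun j => (X (i, j) : MvPolynomial (Fin n × Fin n) ℂ))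
  have hR : ∀ a : Fin r, (∑ j : Fin n, (X (σ (φ a), τ j) : MvPolynomial (Fin n × Fin n) ℂ)) =
      ∑ j : Fin n, (X (σ (φ a), j) : MvPolynomial (Fin n × Fin n) ℂ) := fun a =>
    Equiv.sum_comp τ (fun j => (X (σ (φ a), j) : MvPolynomial (Fin n × Fin n) ℂ))
  have hC : ∀ b : Fin c, (∑ j : Fin n, (X (σ j, τ (ψ b)) : MvPolynomial (Fin n × Fin n) ℂ)) =
      ∑ j : Fin n, (X (j, τ (ψ b)) : MvPolynomial (Fin n × Fin n) ℂ) := fun b =>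
    Equiv.sum_comp σ (fun j => (X (j, τ (ψ b)) : MvPolynomial (Fin n × Fin n) ℂ))
  simp_rw [hU, hR, hC]

/-! ### The theorem -/

/-- **Untwisted `ΠΣ` in span currency.**  A finite family of placed local affine forms (cores `r_i + c_i + 1 ≤ w`) that is
exactly permuted by every row/column permutation has its product in `span_ℂ {hom_{F,n} : tw F ≤ w}`.
[folklore; cite: DwivediPagoSeppelt2026, §8] -/
theorem prod_mem_narrowSpan_of_stable_localFactors (n w : ℕ) {ι : Type} [Fintype ι]
    (Lf : ι → MvPolynomial (Fin n × Fin n) ℂ)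
    (hstab : ∀ σ τ : Perm (Fin n), ∃ κ : Perm ι, ∀ i,
      rename (fun P : Fin n × Fin n => (σ P.1, τ P.2)) (Lf i) = Lf (κ i))
    (hloc : ∀ i, ∃ (r c : ℕ) (eR : Fin r → Fin n) (eC : Fin c → Fin n) (β₀ δ : ℂ) (α : Fin r × Fin c → ℂ)
      (β : Fin r → ℂ) (γ : Fin c → ℂ), r + c + 1 ≤ w ∧ Function.Injective eR ∧ Function.Injective eC ∧
      Lf i = (C β₀ + C δ * ∑ i : Fin n, ∑ j : Fin n, (X (i, j) : MvPolynomial (Fin n × Fin n) ℂ)) +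
        ((∑ ab : Fin r × Fin c, C (α ab) * (X (eR ab.1, eC ab.2) : MvPolynomial (Fin n × Fin n) ℂ)) +
          (∑ a : Fin r, C (β a) * ∑ j : Fin n, (X (eR a, j) : MvPolynomial (Fin n × Fin n) ℂ)) +
          (∑ b : Fin c, C (γ b) * ∑ j : Fin n, (X (j, eC b) : MvPolynomial (Fin n × Fin n) ℂ)))) :
    (∏ i, Lf i) ∈ Submodule.span ℂ {p : MvPolynomial (Fin n × Fin n) ℂ |
        ∃ (a b : ℕ) (E : Multiset (Fin a × Fin b)),
          treewidth (SimpleGraph.fromRel fun u v : Fin a ⊕ Fin b =>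
            ∃ e ∈ E, u = Sum.inl e.1 ∧ v = Sum.inr e.2) ≤ w ∧ p = homPoly E n ℂ} := by
  classical
  refine NarrowSpanNewton.prod_mem_narrowSpan_of_psum_mem n w Lf fun m => ?_
  -- |G| • P_m = Σ_i Σ_{σ,τ} ((σ,τ)·L_i)^m
  have hG : ∀ σ τ : Perm (Fin n), (∑ i, (rename (fun P : Fin n × Fin n => (σ P.1, τ P.2)) (Lf i)) ^ m) =
      ∑ i, Lf i ^ m := by
    intro σ τ
    obtain ⟨κ, hκ⟩ := hstab σ τ
    simp_rw [hκ]
    exact Equiv.sum_comp κ (fun i => Lf i ^ m)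
  have hsum : (∑ i, ∑ σ : Perm (Fin n), ∑ τ : Perm (Fin n),
        (rename (fun P : Fin n × Fin n => (σ P.1, τ P.2)) (Lf i)) ^ m) =
      (Fintype.card (Perm (Fin n)) * Fintype.card (Perm (Fin n))) • ∑ i, Lf i ^ m := by
    rw [Finset.sum_comm]
    have h2 : ∀ σ : Perm (Fin n), (∑ i, ∑ τ : Perm (Fin n),
        (rename (fun P : Fin n × Fin n => (σ P.1, τ P.2)) (Lf i)) ^ m) =
        Fintype.card (Perm (Fin n)) • ∑ i, Lf i ^ m := by
      intro σ
      rw [Finset.sum_comm]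
      simp_rw [hG]
      rw [Finset.sum_const, Finset.card_univ]
    simp_rw [h2]
    rw [Finset.sum_const, Finset.card_univ, smul_smul]
  -- each inner double average is a multiple of an injective-placement power sum
  have hmem : (∑ i, ∑ σ : Perm (Fin n), ∑ τ : Perm (Fin n),
        (rename (fun P : Fin n × Fin n => (σ P.1, τ P.2)) (Lf i)) ^ m) ∈
      Submodule.span ℂ {p : MvPolynomial (Fin n × Fin n) ℂ |
        ∃ (a b : ℕ) (E : Multiset (Fin a × Fin b)),
          treewidth (SimpleGraph.fromRel fun u v : Fin a ⊕ Fin b =>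
            ∃ e ∈ E, u = Sum.inl e.1 ∧ v = Sum.inr e.2) ≤ w ∧ p = homPoly E n ℂ} := by
    refine Submodule.sum_mem _ fun i _ => ?_
    obtain ⟨r, c, eR, eC, β₀, δ, α, β, γ, hw, heR, heC, hLi⟩ := hloc i
    obtain ⟨N₁, -, hN₁⟩ := exists_sum_perm_comp_eq eR heR
    obtain ⟨N₂, -, hN₂⟩ := exists_sum_perm_comp_eq eC heC
    rw [hLi]
    simp only [rename_localForm]
    have h1 := hN₁ (fun φ => ∑ τ : Perm (Fin n),
      ((C β₀ + C δ * ∑ i : Fin n, ∑ j : Fin n, (X (i, j) : MvPolynomial (Fin n × Fin n) ℂ)) +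
        ((∑ ab : Fin r × Fin c, C (α ab) * (X (φ ab.1, (⇑τ ∘ eC) ab.2) : MvPolynomial (Fin n × Fin n) ℂ)) +
          (∑ a : Fin r, C (β a) * ∑ j : Fin n, (X (φ a, j) : MvPolynomial (Fin n × Fin n) ℂ)) +
          (∑ b : Fin c, C (γ b) * ∑ j : Fin n, (X (j, (⇑τ ∘ eC) b) : MvPolynomial (Fin n × Fin n) ℂ)))) ^ m)
    rw [h1]
    have h2 : ∀ φ : Fin r → Fin n, (∑ τ : Perm (Fin n),
      ((C β₀ + C δ * ∑ i : Fin n, ∑ j : Fin n, (X (i, j) : MvPolynomial (Fin n × Fin n) ℂ)) +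
        ((∑ ab : Fin r × Fin c, C (α ab) * (X (φ ab.1, (⇑τ ∘ eC) ab.2) : MvPolynomial (Fin n × Fin n) ℂ)) +
          (∑ a : Fin r, C (β a) * ∑ j : Fin n, (X (φ a, j) : MvPolynomial (Fin n × Fin n) ℂ)) +
          (∑ b : Fin c, C (γ b) * ∑ j : Fin n, (X (j, (⇑τ ∘ eC) b) : MvPolynomial (Fin n × Fin n) ℂ)))) ^ m) =
      N₂ • ∑ ψ ∈ (univ : Finset (Fin c → Fin n)).filter (fun ψ => Function.Injective ψ),
        ((C β₀ + C δ * ∑ i : Fin n, ∑ j : Fin n, (X (i, j) : MvPolynomial (Fin n × Fin n) ℂ)) +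
          ((∑ ab : Fin r × Fin c, C (α ab) * (X (φ ab.1, ψ ab.2) : MvPolynomial (Fin n × Fin n) ℂ)) +
            (∑ a : Fin r, C (β a) * ∑ j : Fin n, (X (φ a, j) : MvPolynomial (Fin n × Fin n) ℂ)) +
            (∑ b : Fin c, C (γ b) * ∑ j : Fin n, (X (j, ψ b) : MvPolynomial (Fin n × Fin n) ℂ)))) ^ m := by
      intro φ
      have h := hN₂ (fun ψ =>
        ((C β₀ + C δ * ∑ i : Fin n, ∑ j : Fin n, (X (i, j) : MvPolynomial (Fin n × Fin n) ℂ)) +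
          ((∑ ab : Fin r × Fin c, C (α ab) * (X (φ ab.1, ψ ab.2) : MvPolynomial (Fin n × Fin n) ℂ)) +
            (∑ a : Fin r, C (β a) * ∑ j : Fin n, (X (φ a, j) : MvPolynomial (Fin n × Fin n) ℂ)) +
            (∑ b : Fin c, C (γ b) * ∑ j : Fin n, (X (j, ψ b) : MvPolynomial (Fin n × Fin n) ℂ)))) ^ m)
      exact h
    simp_rw [h2]
    simp_rw [← Finset.smul_sum]
    refine nsmul_mem (nsmul_mem ?_ _) _
    have hmono : Submodule.span ℂ {p : MvPolynomial (Fin n × Fin n) ℂ |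
        ∃ (a b : ℕ) (E : Multiset (Fin a × Fin b)),
          treewidth (SimpleGraph.fromRel fun u v : Fin a ⊕ Fin b =>
            ∃ e ∈ E, u = Sum.inl e.1 ∧ v = Sum.inr e.2) ≤ r + c + 1 ∧ p = homPoly E n ℂ} ≤
      Submodule.span ℂ {p : MvPolynomial (Fin n × Fin n) ℂ |
        ∃ (a b : ℕ) (E : Multiset (Fin a × Fin b)),
          treewidth (SimpleGraph.fromRel fun u v : Fin a ⊕ Fin b =>
            ∃ e ∈ E, u = Sum.inl e.1 ∧ v = Sum.inr e.2) ≤ w ∧ p = homPoly E n ℂ} := by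
      refine Submodule.span_mono ?_
      rintro p ⟨a, b, E, hE, rfl⟩
      exact ⟨a, b, E, hE.trans hw, rfl⟩
    exact hmono (sum_injective_injective_pow_affineLocalForm_mem_narrowSpan n r c m β₀ δ α β γ)
  -- divide by |G|
  have hcard : ((Fintype.card (Perm (Fin n)) * Fintype.card (Perm (Fin n)) : ℕ) : ℂ) ≠ 0 := by
    have : 0 < Fintype.card (Perm (Fin n)) := Fintype.card_pos
    exact_mod_cast (Nat.mul_pos this this).ne'
  have : (∑ i, Lf i ^ m) = ((Fintype.card (Perm (Fin n)) * Fintype.card (Perm (Fin n)) : ℕ) : ℂ)⁻¹ •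
      ((Fintype.card (Perm (Fin n)) * Fintype.card (Perm (Fin n))) • ∑ i, Lf i ^ m) := by
    rw [← Nat.cast_smul_eq_nsmul ℂ, inv_smul_smul₀ hcard]
  rw [this, ← hsum]
  exact Submodule.smul_mem _ _ hmem

end CorePatterns

end Summit.ValiantsHypothesis.ValiantsHypothesis.Theorems

end
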